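import Summits.KontsevichZagierPeriods.KontsevichZagierPeriods.Theorems.SymplecticScissorsRealOnePeriodRelationsStubEllPath
import Mathlib.Analysis.SpecialFunctions.Sqrt
import Mathlib.FieldTheory.IsAlgClosed.Basic
import Mathlib.Analysis.Complex.Polynomial.Basic

/-!
# `RealOnePeriodRelations` (stmt-KontsevichZagierPeriods-10042), line `nash-retraction-thin-strip`,
# loop layer: stub `stub_branchPath` — THE BRANCH LOOP

`E : y² = f(x) = x³ + Ax + B` real algebraic, `e` its largest real root, `c` another (complex) root,
`F = f′(c) ≠ 0`.  The translate of the real branch `{x ≥ e} ∪ {O}` by the `2`-torsion point `(c, 0)`,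
`(x, y) ↦ (c + F/(x − c), −F y/(x − c)²)`, is a closed loop INSIDE the affine curve.  With
`x(t) = e + t²(1 − t)²/(t − ½)²`, `s = t − ½`, `u = t(1 − t)`, `D = (e − c)s² + u²`,
`M = (es² + u²)² + es²(es² + u²) + (e² + A)s⁴` it is `t ↦ (c + F s²/D, F s u √M / D²)`:
`x − c = D/s²`, `s⁶ f(x) = u² M`, `D ≠ 0` and `M > 0` on all of `ℝ` (so the loop is smooth), and on
the curve `u² M = D (D² + 3c s² D + F s⁴)`.  Folklore algebra and calculus; the semialgebraicity
clause is Tarski–Seidenberg bookkeeping with the tree's real and complex (`re_im_*`) kits.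
-/

noncomputable section

open scoped BigOperators Polynomial
open Set MeasureTheory MvPolynomial
open Literature.NumberTheory.Transcendental Literature.NumberTheory.Transcendental.CurvePeriods
open Literature.ModelTheory.ExponentialFields (IsSemialgebraic)

namespace Summit.KontsevichZagierPeriods.SymplecticScissors.RealOnePeriodRelations.LoopLayer

namespace BranchPath

open EllipticLayer (deriv_ne_zero_of_root deriv_pos_of_root_left)

/-- A SECOND ROOT.  For a simple real root `e` of `f = x³ + Ax + B` there is a complex root `c` of
the cofactor `X² + eX + e² + A` (so `f(c) = 0`); it is algebraic when `A, e` are, `c ≠ e` and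
`f′(c) = 3c² + A ≠ 0` (Bézout: `f(c) = f′(c) = 0` forces `4A³ + 27B² = 0`). [folklore] -/
theorem exists_root {A B e : ℝ} (hA : IsAlgebraic ℚ A) (he : IsAlgebraic ℚ e)
    (hD : 4 * A ^ 3 + 27 * B ^ 2 ≠ 0) (he0 : e ^ 3 + A * e + B = 0) :
    ∃ c : ℂ, IsAlgebraic ℚ c ∧ c ^ 2 + (e : ℂ) * c + ((e : ℂ) ^ 2 + (A : ℂ)) = 0 ∧
      c ^ 3 + (A : ℂ) * c + (B : ℂ) = 0 ∧ 3 * c ^ 2 + (A : ℂ) ≠ 0 ∧ c ≠ (e : ℂ) := by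
  obtain ⟨d, hd⟩ := IsAlgClosed.exists_pow_nat_eq (-(3 * (e : ℂ) ^ 2 + 4 * (A : ℂ))) two_pos
  have he0' : (e : ℂ) ^ 3 + (A : ℂ) * e + B = 0 := by exact_mod_cast he0
  have hD' : (4 * (A : ℂ) ^ 3 + 27 * (B : ℂ) ^ 2) ≠ 0 := by exact_mod_cast hD
  have hq : ((d - e) / 2) ^ 2 + (e : ℂ) * ((d - e) / 2) + ((e : ℂ) ^ 2 + (A : ℂ)) = 0 := by
    linear_combination hd / 4
  have hc : ((d - e) / 2) ^ 3 + (A : ℂ) * ((d - e) / 2) + (B : ℂ) = 0 := by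
    linear_combination ((d - e) / 2 - e) * hq + he0'
  refine ⟨(d - e) / 2, ?_, hq, hc, fun h => hD' ?_, fun h => ?_⟩
  · have hd_alg : IsAlgebraic ℚ d := IsAlgebraic.of_pow two_pos (hd ▸ (((isAlgebraic_nat 3).mul
      (he.algebraMap.pow 2)).add ((isAlgebraic_nat 4).mul hA.algebraMap)).neg)
    rw [div_eq_mul_inv]
    exact (hd_alg.sub he.algebraMap).mul (isAlgebraic_nat 2).inv
  · linear_combination (6 * A * ((d - e) / 2) ^ 2 - 9 * B * ((d - e) / 2) + 4 * A ^ 2) * h -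
      (18 * A * ((d - e) / 2) - 27 * B) * hc
  · rw [h] at hq
    refine deriv_ne_zero_of_root hD he0 ?_
    exact_mod_cast (by linear_combination hq : 3 * (e : ℂ) ^ 2 + A = 0)

/-- The cofactor `q(x) = x² + ex + e² + A` of the largest real root `e` (`f = (x − e) q`, `f > 0` on
`(e, ∞)`) is positive on `[e, ∞)`: `q = f/(x − e) > 0` right of `e` and `q(e) = f′(e) > 0`.
[folklore] -/
theorem cofactor_pos {A B e : ℝ} (hD : 4 * A ^ 3 + 27 * B ^ 2 ≠ 0) (he0 : e ^ 3 + A * e + B = 0)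
    (hpos : ∀ x : ℝ, e < x → 0 < x ^ 3 + A * x + B) {x : ℝ} (hx : e ≤ x) :
    0 < x ^ 2 + e * x + e ^ 2 + A := by
  rcases hx.eq_or_lt with rfl | hlt
  · nlinarith [deriv_pos_of_root_left (lt_add_one e) hD (fun x hx => hpos x hx.1) he0]
  · exact pos_of_mul_pos_right (by nlinarith [hpos x hlt]) (sub_pos.2 hlt).le

/-- The abscissa `x(t) = e + t²(1 − t)²/(t − ½)² ≥ e` of the branch is never the second root `c`:
otherwise `c` would be a real root `≥ e` of `f`, i.e. `c = e` or `f(c) > 0`. [folklore] -/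
theorem ofReal_x_ne {A B e : ℝ} {c : ℂ} (hpos : ∀ x : ℝ, e < x → 0 < x ^ 3 + A * x + B)
    (hc : c ^ 3 + (A : ℂ) * c + (B : ℂ) = 0) (hce : c ≠ (e : ℂ)) (t : ℝ) :
    (((e + (t * (1 - t)) ^ 2 / (t - 1 / 2) ^ 2 : ℝ)) : ℂ) ≠ c := by
  intro h
  have hxe : e ≤ e + (t * (1 - t)) ^ 2 / (t - 1 / 2) ^ 2 :=
    le_add_of_nonneg_right (div_nonneg (sq_nonneg _) (sq_nonneg _))
  rcases hxe.eq_or_lt with hxe | hxe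
  · exact hce (by rw [← h, ← hxe])
  · have h0 := hpos _ hxe
    rw [← h] at hc
    have hc' : (e + (t * (1 - t)) ^ 2 / (t - 1 / 2) ^ 2) ^ 3 +
        A * (e + (t * (1 - t)) ^ 2 / (t - 1 / 2) ^ 2) + B = 0 := by exact_mod_cast hc
    linarith

/-- THE CURVE EQUATION for the loop: ON THE CURVE `U² M = D (D² + 3c S² D + (3c² + A) S⁴)` (`c` a
root of the cofactor), so if `Y² = S² U² M` then `((3c² + A) Y / D²)² = g(c + (3c² + A) S²/D)`,
`g = X³ + AX + B`, for `D ≠ 0`. [folklore] -/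
theorem curve_equation {A B e c S S₂ U Y D : ℂ} (hq : c ^ 2 + e * c + (e ^ 2 + A) = 0)
    (hc : c ^ 3 + A * c + B = 0) (hS₂ : S₂ = S ^ 2) (hDdef : D = (e - c) * S ^ 2 + U ^ 2)
    (hD : D ≠ 0) (hY : Y ^ 2 = S ^ 2 * U ^ 2 *
      ((e * S ^ 2 + U ^ 2) ^ 2 + e * S ^ 2 * (e * S ^ 2 + U ^ 2) + (e ^ 2 + A) * S ^ 4)) :
    ((3 * c ^ 2 + A) * Y / D ^ 2) ^ 2 =
      (c + (3 * c ^ 2 + A) * S₂ / D) ^ 3 + A * (c + (3 * c ^ 2 + A) * S₂ / D) + B := by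
  subst hS₂
  have key : U ^ 2 * ((e * S ^ 2 + U ^ 2) ^ 2 + e * S ^ 2 * (e * S ^ 2 + U ^ 2) + (e ^ 2 + A) * S ^ 4) =
      D * (D ^ 2 + 3 * c * S ^ 2 * D + (3 * c ^ 2 + A) * S ^ 4) := by
    rw [hDdef]; linear_combination (c - e) * S ^ 6 * hq
  have hDi : D * D⁻¹ = 1 := mul_inv_cancel₀ hD
  rw [div_eq_mul_inv, div_eq_mul_inv, ← inv_pow]
  generalize D⁻¹ = Di at hDi ⊢
  linear_combination ((3 * c ^ 2 + A) ^ 2 * Di ^ 4) * hY +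
    ((3 * c ^ 2 + A) ^ 2 * S ^ 2 * Di ^ 4) * key +
    ((3 * c ^ 2 + A) ^ 2 * S ^ 2 * Di * (D ^ 2 * Di ^ 2 + D * Di + 1) +
      3 * c * (3 * c ^ 2 + A) ^ 2 * S ^ 4 * Di ^ 2 * (D * Di + 1) +
      (3 * c ^ 2 + A) ^ 3 * S ^ 6 * Di ^ 3) * hDi - hc

/-- `M = (es² + u²)² + es²(es² + u²) + (e² + A)s⁴ = s⁴ q(e + u²/s²)` for `s ≠ 0`. [folklore] -/
theorem M_eq {A e s u : ℝ} (hs : s ≠ 0) :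
    (e * s ^ 2 + u ^ 2) ^ 2 + e * s ^ 2 * (e * s ^ 2 + u ^ 2) + (e ^ 2 + A) * s ^ 4 =
      s ^ 4 * ((e + u ^ 2 / s ^ 2) ^ 2 + e * (e + u ^ 2 / s ^ 2) + e ^ 2 + A) := by
  field_simp
  ring

/-- `M > 0` on all of `ℝ` (`M = u⁴` at `s = 0`, `M = s⁴ q(x) > 0` elsewhere as `x ≥ e`). [folklore] -/
theorem M_pos {A B e : ℝ} (hD : 4 * A ^ 3 + 27 * B ^ 2 ≠ 0) (he0 : e ^ 3 + A * e + B = 0)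
    (hpos : ∀ x : ℝ, e < x → 0 < x ^ 3 + A * x + B) (t : ℝ) :
    0 < (e * (t - 1 / 2) ^ 2 + (t * (1 - t)) ^ 2) ^ 2 +
        e * (t - 1 / 2) ^ 2 * (e * (t - 1 / 2) ^ 2 + (t * (1 - t)) ^ 2) +
          (e ^ 2 + A) * (t - 1 / 2) ^ 4 := by
  rcases eq_or_ne (t - 1 / 2) 0 with ht | ht
  · have ht' : t = 1 / 2 := by linarith
    subst ht'
    norm_num
  · rw [M_eq ht]
    exact mul_pos (by positivity) (cofactor_pos hD he0 hpos
      (le_add_of_nonneg_right (div_nonneg (sq_nonneg _) (sq_nonneg _))))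

/-- For `s ≠ 0`: `f(e + u²/s²) = (u √M / s³)²` (`f = (x − e) q`, `x − e = u²/s²`, `M = s⁴ q(x)`).
[folklore] -/
theorem f_x_eq_sq {A B e s u : ℝ} (he0 : e ^ 3 + A * e + B = 0) (hs : s ≠ 0)
    (hM : 0 ≤ (e * s ^ 2 + u ^ 2) ^ 2 + e * s ^ 2 * (e * s ^ 2 + u ^ 2) + (e ^ 2 + A) * s ^ 4) :
    (e + u ^ 2 / s ^ 2) ^ 3 + A * (e + u ^ 2 / s ^ 2) + B =
      (u * Real.sqrt ((e * s ^ 2 + u ^ 2) ^ 2 + e * s ^ 2 * (e * s ^ 2 + u ^ 2) + (e ^ 2 + A) * s ^ 4) /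
        s ^ 3) ^ 2 := by
  rw [div_pow, mul_pow, Real.sq_sqrt hM, M_eq hs]
  have hid : (e + u ^ 2 / s ^ 2) ^ 3 + A * (e + u ^ 2 / s ^ 2) + B =
      (e + u ^ 2 / s ^ 2 - e) * ((e + u ^ 2 / s ^ 2) ^ 2 + e * (e + u ^ 2 / s ^ 2) + e ^ 2 + A) := by
    linear_combination he0
  rw [hid]
  field_simp
  ring

/-- `√f(x) = u √M / |s|³` for `s ≠ 0`, `u ≥ 0` (`x = e + u²/s²`). [folklore] -/
theorem sqrt_f_x {A B e s u : ℝ} (he0 : e ^ 3 + A * e + B = 0) (hs : s ≠ 0) (hu : 0 ≤ u)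
    (hM : 0 ≤ (e * s ^ 2 + u ^ 2) ^ 2 + e * s ^ 2 * (e * s ^ 2 + u ^ 2) + (e ^ 2 + A) * s ^ 4) :
    Real.sqrt ((e + u ^ 2 / s ^ 2) ^ 3 + A * (e + u ^ 2 / s ^ 2) + B) =
      u * Real.sqrt ((e * s ^ 2 + u ^ 2) ^ 2 + e * s ^ 2 * (e * s ^ 2 + u ^ 2) + (e ^ 2 + A) * s ^ 4) /
        |s| ^ 3 := by
  rw [f_x_eq_sq he0 hs hM, Real.sqrt_sq_eq_abs, abs_div, abs_mul, abs_of_nonneg hu,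
    abs_of_nonneg (Real.sqrt_nonneg _), abs_pow]

/-- `D = (x − c) s²` for `s ≠ 0`. [folklore] -/
theorem D_eq {e s u : ℝ} (c : ℂ) (hs : s ≠ 0) :
    ((e : ℂ) - c) * ((s ^ 2 : ℝ) : ℂ) + ((u ^ 2 : ℝ) : ℂ) =
      (((e + u ^ 2 / s ^ 2 : ℝ) : ℂ) - c) * ((s ^ 2 : ℝ) : ℂ) := by
  have hs' : (s : ℂ) ≠ 0 := by exact_mod_cast hs
  push_cast
  field_simp
  ring

/-- First coordinate: `c + F s²/D = c + F/(x − c)` for `s ≠ 0`. [folklore] -/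
theorem fst_eq {A e s u : ℝ} (c : ℂ) (hs : s ≠ 0) :
    c + (3 * c ^ 2 + (A : ℂ)) * ((s ^ 2 : ℝ) : ℂ) / (((e : ℂ) - c) * ((s ^ 2 : ℝ) : ℂ) + ((u ^ 2 : ℝ) : ℂ)) =
      c + (3 * c ^ 2 + (A : ℂ)) / (((e + u ^ 2 / s ^ 2 : ℝ) : ℂ) - c) := by
  have hs2 : ((s ^ 2 : ℝ) : ℂ) ≠ 0 := by exact_mod_cast pow_ne_zero 2 hs
  rw [D_eq c hs, mul_div_mul_right _ _ hs2]

section Halves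

variable {A B e s u : ℝ} {c : ℂ} (he0 : e ^ 3 + A * e + B = 0) (hu : 0 ≤ u)
  (hM : 0 ≤ (e * s ^ 2 + u ^ 2) ^ 2 + e * s ^ 2 * (e * s ^ 2 + u ^ 2) + (e ^ 2 + A) * s ^ 4)
  (hxc : ((e + u ^ 2 / s ^ 2 : ℝ) : ℂ) ≠ c)
include he0 hu hM hxc

/-- First half (`s < 0`, `y = +√f(x)`): `F s u √M / D² = −F √f(x)/(x − c)²`. [folklore] -/
theorem snd_eq_of_neg (hs : s < 0) :
    (3 * c ^ 2 + (A : ℂ)) * ((s * u * Real.sqrt ((e * s ^ 2 + u ^ 2) ^ 2 +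
        e * s ^ 2 * (e * s ^ 2 + u ^ 2) + (e ^ 2 + A) * s ^ 4) : ℝ) : ℂ) /
          (((e : ℂ) - c) * ((s ^ 2 : ℝ) : ℂ) + ((u ^ 2 : ℝ) : ℂ)) ^ 2 =
      -(3 * c ^ 2 + (A : ℂ)) *
          ((Real.sqrt ((e + u ^ 2 / s ^ 2) ^ 3 + A * (e + u ^ 2 / s ^ 2) + B) : ℝ) : ℂ) /
        (((e + u ^ 2 / s ^ 2 : ℝ) : ℂ) - c) ^ 2 := by
  rw [sqrt_f_x he0 hs.ne hu hM, abs_of_neg hs, D_eq c hs.ne]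
  have hs' : (s : ℂ) ≠ 0 := by exact_mod_cast hs.ne
  have hxc' : ((e + u ^ 2 / s ^ 2 : ℝ) : ℂ) - c ≠ 0 := sub_ne_zero.2 hxc
  generalize ((e + u ^ 2 / s ^ 2 : ℝ) : ℂ) - c = W at hxc' ⊢
  push_cast
  field_simp

/-- Second half (`s > 0`, `y = −√f(x)`): `F s u √M / D² = F √f(x)/(x − c)²`. [folklore] -/
theorem snd_eq_of_pos (hs : 0 < s) :
    (3 * c ^ 2 + (A : ℂ)) * ((s * u * Real.sqrt ((e * s ^ 2 + u ^ 2) ^ 2 +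
        e * s ^ 2 * (e * s ^ 2 + u ^ 2) + (e ^ 2 + A) * s ^ 4) : ℝ) : ℂ) /
          (((e : ℂ) - c) * ((s ^ 2 : ℝ) : ℂ) + ((u ^ 2 : ℝ) : ℂ)) ^ 2 =
      (3 * c ^ 2 + (A : ℂ)) *
          ((Real.sqrt ((e + u ^ 2 / s ^ 2) ^ 3 + A * (e + u ^ 2 / s ^ 2) + B) : ℝ) : ℂ) /
        (((e + u ^ 2 / s ^ 2 : ℝ) : ℂ) - c) ^ 2 := by
  rw [sqrt_f_x he0 hs.ne' hu hM, abs_of_pos hs, D_eq c hs.ne']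
  have hs' : (s : ℂ) ≠ 0 := by exact_mod_cast hs.ne'
  have hxc' : ((e + u ^ 2 / s ^ 2 : ℝ) : ℂ) - c ≠ 0 := sub_ne_zero.2 hxc
  generalize ((e + u ^ 2 / s ^ 2 : ℝ) : ℂ) - c = W at hxc' ⊢
  push_cast
  field_simp

end Halves

/-- A real `Cⁿ` function is `Cⁿ` as a complex-valued function. [folklore] -/
theorem contDiff_ofReal_comp {n : WithTop ℕ∞} {f : ℝ → ℝ} (hf : ContDiff ℝ n f) :
    ContDiff ℝ n (fun t => ((f t : ℝ) : ℂ)) :=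
  Complex.ofRealCLM.contDiff.comp hf

end BranchPath

open BranchPath in
/-- STUB `stub_branchPath` — THE BRANCH LOOP.  For real algebraic `A, B` with `4A³ + 27B² ≠ 0` and a real root `e` of
`f = x³ + Ax + B` with `f > 0` on `(e, ∞)` (the largest real root), let `c` be another root of `f` (real or complex) and
`F = f′(c) = 3c² + A ≠ 0`.  The translate of the real branch `{x ≥ e} ∪ {O}` by the `2`-torsion point `(c, 0)`,
`(x, y) ↦ (c + F/(x − c), −F y/(x − c)²)`, is a CLOSED `C¹` path on `E_{A,B}` from `(−e−c, 0)` through `(c, 0)` (the image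
of `O`) back to `(−e−c, 0)`, with `ℚ`-semialgebraic real and imaginary parts; parametrising the branch by
`x(t) = e + t²(1 − t)²/(t − ½)²` (`x → ∞` as `t → ½`), the loop is, with `s = t − ½`, `D(s) = (e − c)s² + (¼ − s²)²`,
`M(s) = X₂² + e s² X₂ + (e² + A)s⁴`, `X₂ = e s² + (¼ − s²)²`: `t ↦ (c + F s²/D(s), F s (¼ − s²) √M(s) / D(s)²)` — rational
functions and the square root of a positive polynomial, smooth on `[0,1]` including `t = ½`. [folklore] -/
theorem stub_branchPath : ∀ (A B e : ℝ), IsAlgebraic ℚ A → IsAlgebraic ℚ B → IsAlgebraic ℚ e → 4 * A ^ 3 + 27 * B ^ 2 ≠ 0 →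
    e ^ 3 + A * e + B = 0 → (∀ x : ℝ, e < x → 0 < x ^ 3 + A * x + B) →
    ∃ (c : ℂ) (γ : CurvePath (weierCurve (A : ℂ) (B : ℂ))),
      c ^ 3 + (A : ℂ) * c + (B : ℂ) = 0 ∧ 3 * c ^ 2 + (A : ℂ) ≠ 0 ∧
      (∀ t ∈ Set.Ioo (0 : ℝ) 1, t ≠ 1 / 2 → (((e + (t * (1 - t)) ^ 2 / (t - 1 / 2) ^ 2 : ℝ)) : ℂ) ≠ c) ∧
      γ.toFun 1 = γ.toFun 0 ∧
      (∀ t ∈ Set.Ioo (0 : ℝ) (1 / 2), γ.toFun t =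
        ![c + (3 * c ^ 2 + (A : ℂ)) / ((((e + (t * (1 - t)) ^ 2 / (t - 1 / 2) ^ 2 : ℝ)) : ℂ) - c),
          -(3 * c ^ 2 + (A : ℂ)) *
              ((Real.sqrt ((e + (t * (1 - t)) ^ 2 / (t - 1 / 2) ^ 2) ^ 3 + A * (e + (t * (1 - t)) ^ 2 / (t - 1 / 2) ^ 2) + B) : ℝ) : ℂ) /
            ((((e + (t * (1 - t)) ^ 2 / (t - 1 / 2) ^ 2 : ℝ)) : ℂ) - c) ^ 2]) ∧
      (∀ t ∈ Set.Ioo (1 / 2 : ℝ) 1, γ.toFun t =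
        ![c + (3 * c ^ 2 + (A : ℂ)) / ((((e + (t * (1 - t)) ^ 2 / (t - 1 / 2) ^ 2 : ℝ)) : ℂ) - c),
          (3 * c ^ 2 + (A : ℂ)) *
              ((Real.sqrt ((e + (t * (1 - t)) ^ 2 / (t - 1 / 2) ^ 2) ^ 3 + A * (e + (t * (1 - t)) ^ 2 / (t - 1 / 2) ^ 2) + B) : ℝ) : ℂ) /
            ((((e + (t * (1 - t)) ^ 2 / (t - 1 / 2) ^ 2 : ℝ)) : ℂ) - c) ^ 2]) ∧
      IsSemialgebraicMapOn ℚ {z : Fin 1 → ℝ | z 0 ∈ Set.Icc (0 : ℝ) 1}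
        (fun z => Fin.append (fun i => (γ.toFun (z 0) i).re) (fun i => (γ.toFun (z 0) i).im)) := by
  intro A B e hA hB he hD he0 hpos
  obtain ⟨c, hc_alg, hq, hc, hF, hce⟩ := exists_root hA he hD he0
  have he' : IsAlgebraic ℚ (e : ℂ) := he.algebraMap
  have hF_alg : IsAlgebraic ℚ (3 * c ^ 2 + (A : ℂ)) :=
    ((isAlgebraic_nat 3).mul (hc_alg.pow 2)).add hA.algebraMap
  have hMpos := M_pos hD he0 hpos
  have hxc := ofReal_x_ne hpos hc hce
  -- the functions `M`, `D` and the two coordinates `G1`, `G2` of the loop `t ↦ ![G1 t, G2 t]`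
  obtain ⟨M, hM⟩ : ∃ M : ℝ → ℝ, ∀ t, M t = (e * (t - 1 / 2) ^ 2 + (t * (1 - t)) ^ 2) ^ 2 +
      e * (t - 1 / 2) ^ 2 * (e * (t - 1 / 2) ^ 2 + (t * (1 - t)) ^ 2) + (e ^ 2 + A) * (t - 1 / 2) ^ 4 :=
    ⟨_, fun _ => rfl⟩
  obtain ⟨D, hDdef⟩ : ∃ D : ℝ → ℂ, ∀ t, D t =
      ((e : ℂ) - c) * (((t - 1 / 2) ^ 2 : ℝ) : ℂ) + ((((t * (1 - t)) ^ 2 : ℝ)) : ℂ) := ⟨_, fun _ => rfl⟩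
  have hD0 : ∀ t, D t ≠ 0 := by
    intro t
    rw [hDdef]
    rcases eq_or_ne (t - 1 / 2) 0 with ht | ht
    · have ht' : t = 1 / 2 := by linarith
      subst ht'
      norm_num
    · rw [D_eq c ht]
      exact mul_ne_zero (sub_ne_zero.2 (hxc t)) (by exact_mod_cast pow_ne_zero 2 ht)
  obtain ⟨G1, hG1⟩ : ∃ G : ℝ → ℂ, ∀ t, G t =
      c + (3 * c ^ 2 + (A : ℂ)) * (((t - 1 / 2) ^ 2 : ℝ) : ℂ) / D t := ⟨_, fun _ => rfl⟩
  obtain ⟨G2, hG2⟩ : ∃ G : ℝ → ℂ, ∀ t, G t =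
      (3 * c ^ 2 + (A : ℂ)) * (((t - 1 / 2) * (t * (1 - t)) * Real.sqrt (M t) : ℝ) : ℂ) / D t ^ 2 :=
    ⟨_, fun _ => rfl⟩
  -- end points and regularity
  have hec : (e : ℂ) - c ≠ 0 := sub_ne_zero.2 hce.symm
  have hD_0 : D 0 = ((e : ℂ) - c) / 4 := by rw [hDdef]; push_cast; ring
  have hD_1 : D 1 = ((e : ℂ) - c) / 4 := by rw [hDdef]; push_cast; ring
  have hG1_0 : G1 0 = c + (3 * c ^ 2 + (A : ℂ)) / ((e : ℂ) - c) := by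
    rw [hG1, hD_0, div_div_eq_mul_div, add_right_inj, div_left_inj' hec]
    push_cast
    ring
  have hG1_1 : G1 1 = c + (3 * c ^ 2 + (A : ℂ)) / ((e : ℂ) - c) := by
    rw [hG1, hD_1, div_div_eq_mul_div, add_right_inj, div_left_inj' hec]
    push_cast
    ring
  have hG2_0 : G2 0 = 0 := by rw [hG2]; simp
  have hG2_1 : G2 1 = 0 := by rw [hG2]; simp
  have hend : IsAlgebraic ℚ (c + (3 * c ^ 2 + (A : ℂ)) / ((e : ℂ) - c)) := by
    rw [div_eq_mul_inv]
    exact hc_alg.add (hF_alg.mul (he'.sub hc_alg).inv)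
  have hD_cd : ContDiff ℝ 1 D := by
    rw [show D = _ from funext hDdef]
    exact (contDiff_const.mul (contDiff_ofReal_comp (by fun_prop))).add
      (contDiff_ofReal_comp (by fun_prop))
  have hG1_cd : ContDiff ℝ 1 G1 := by
    rw [show G1 = _ from funext hG1]
    simp only [div_eq_mul_inv]
    exact contDiff_const.add ((contDiff_const.mul (contDiff_ofReal_comp (by fun_prop))).mul
      (hD_cd.inv hD0))
  have hM_cd : ContDiff ℝ 1 (fun t => Real.sqrt (M t)) := by
    rw [show M = _ from funext hM]
    exact ContDiff.sqrt (by fun_prop) fun t => (hMpos t).ne'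
  have hG2_cd : ContDiff ℝ 1 G2 := by
    rw [show G2 = _ from funext hG2]
    simp only [div_eq_mul_inv]
    exact (contDiff_const.mul (contDiff_ofReal_comp
      ((by fun_prop : ContDiff ℝ 1 fun t : ℝ => (t - 1 / 2) * (t * (1 - t))).mul hM_cd))).mul
      ((hD_cd.pow 2).inv fun t => pow_ne_zero 2 (hD0 t))
  refine ⟨c,
    { toFun := fun t => ![G1 t, G2 t]
      contDiffOn := by
        refine contDiffOn_pi.2 fun i => ?_
        fin_cases i
        exacts [hG1_cd.contDiffOn, hG2_cd.contDiffOn]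
      mem_points := fun t _ => by
        rw [Weier.mem_points_iff, Weier.eval_fPoly]
        simp only [Matrix.cons_val_one, Matrix.cons_val_zero]
        rw [hG1, hG2]
        have hMt : 0 ≤ M t := by rw [hM]; exact (hMpos t).le
        refine curve_equation (S := ((t - 1 / 2 : ℝ) : ℂ)) (U := ((t * (1 - t) : ℝ) : ℂ)) hq hc
          (by push_cast; ring) (by rw [hDdef]; push_cast; ring) (hD0 t) ?_
        rw [← Complex.ofReal_pow, mul_pow, mul_pow, Real.sq_sqrt hMt, hM]
        push_cast
        ring
      algebraic_zero := fun i => by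
        fin_cases i
        · show IsAlgebraic ℚ (G1 0); rw [hG1_0]; exact hend
        · show IsAlgebraic ℚ (G2 0); rw [hG2_0]; exact isAlgebraic_zero
      algebraic_one := fun i => by
        fin_cases i
        · show IsAlgebraic ℚ (G1 1); rw [hG1_1]; exact hend
        · show IsAlgebraic ℚ (G2 1); rw [hG2_1]; exact isAlgebraic_zero },
    hc, hF, fun t _ _ => hxc t, ?_, ?_, ?_, ?_⟩
  · show (![G1 1, G2 1] : Fin 2 → ℂ) = ![G1 0, G2 0]
    rw [hG1_0, hG1_1, hG2_0, hG2_1]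
  · -- first half: `s = t − ½ < 0`, `y = +√f(x)`
    intro t ht
    have hs : t - 1 / 2 < 0 := by linarith [ht.2]
    have hu : 0 ≤ t * (1 - t) := mul_nonneg ht.1.le (by linarith [ht.2])
    show (![G1 t, G2 t] : Fin 2 → ℂ) = _
    rw [hG1, hG2, hDdef, hM, fst_eq c hs.ne, snd_eq_of_neg he0 hu (hMpos t).le (hxc t) hs]
  · -- second half: `s = t − ½ > 0`, `y = −√f(x)`
    intro t ht
    have hs : 0 < t - 1 / 2 := by linarith [ht.1]
    have hu : 0 ≤ t * (1 - t) := mul_nonneg (by linarith [ht.1]) (by linarith [ht.2])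
    show (![G1 t, G2 t] : Fin 2 → ℂ) = _
    rw [hG1, hG2, hDdef, hM, fst_eq c hs.ne', snd_eq_of_pos he0 hu (hMpos t).le (hxc t) hs]
  · -- the real and imaginary parts are `ℚ`-semialgebraic on `[0, 1]`: real kit, then `re_im_*`
    have hdom : IsSemialgebraic ℚ {z : Fin 1 → ℝ | z 0 ∈ Icc (0 : ℝ) 1} :=
      Realises.isSemialgebraic_IccDom
    have hz : IsSemialgebraicFunOn ℚ {z : Fin 1 → ℝ | z 0 ∈ Icc (0 : ℝ) 1} (fun z => z 0) :=
      (isSemialgebraicFunOn_aeval hdom (X 0)).congr fun z _ => by simp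
    have hhalf : IsSemialgebraicFunOn ℚ {z : Fin 1 → ℝ | z 0 ∈ Icc (0 : ℝ) 1} (fun _ => (1 / 2 : ℝ)) :=
      (isSemialgebraicFunOn_const_ratCast hdom (1 / 2)).congr fun _ _ => by norm_num
    have hone : IsSemialgebraicFunOn ℚ {z : Fin 1 → ℝ | z 0 ∈ Icc (0 : ℝ) 1} (fun _ => (1 : ℝ)) :=
      (isSemialgebraicFunOn_const_natCast hdom 1).congr fun _ _ => Nat.cast_one
    have hs_ := hz.fun_sub hhalf
    have hu_ := hz.fun_mul (hone.fun_sub hz)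
    have he_ := isSemialgebraicFunOn_const_of_isAlgebraic hdom he
    have heA_ := isSemialgebraicFunOn_const_of_isAlgebraic hdom ((he.pow 2).add hA)
    have hS2_ := hs_.fun_pow 2
    have hU2_ := hu_.fun_pow 2
    have hX2_ := (he_.fun_mul hS2_).fun_add hU2_
    have hM_ : IsSemialgebraicFunOn ℚ {z : Fin 1 → ℝ | z 0 ∈ Icc (0 : ℝ) 1} (fun z => M (z 0)) :=
      (((hX2_.fun_pow 2).fun_add ((he_.fun_mul hS2_).fun_mul hX2_)).fun_add
        (heA_.fun_mul (hs_.fun_pow 4))).congr fun z _ => by rw [hM]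
    have hSUM_ := (hs_.fun_mul hu_).fun_mul hM_.fun_sqrt
    have hcri := isAlgebraic_re_im hc_alg
    have hFri := isAlgebraic_re_im hF_alg
    have heci := isAlgebraic_re_im (he'.sub hc_alg)
    have hFc := re_im_const hdom hFri.1 hFri.2
    have hS2c := re_im_ofReal hdom hS2_
    have hDc : IsSemialgebraicFunOn ℚ {z : Fin 1 → ℝ | z 0 ∈ Icc (0 : ℝ) 1} (fun z => (D (z 0)).re) ∧
        IsSemialgebraicFunOn ℚ {z : Fin 1 → ℝ | z 0 ∈ Icc (0 : ℝ) 1} (fun z => (D (z 0)).im) := by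
      have h := re_im_add (re_im_mul (re_im_const hdom heci.1 heci.2) hS2c) (re_im_ofReal hdom hU2_)
      exact ⟨h.1.congr fun z _ => by rw [hDdef], h.2.congr fun z _ => by rw [hDdef]⟩
    have hG1c : IsSemialgebraicFunOn ℚ {z : Fin 1 → ℝ | z 0 ∈ Icc (0 : ℝ) 1} (fun z => (G1 (z 0)).re) ∧
        IsSemialgebraicFunOn ℚ {z : Fin 1 → ℝ | z 0 ∈ Icc (0 : ℝ) 1} (fun z => (G1 (z 0)).im) := by
      have h := re_im_add (re_im_const hdom hcri.1 hcri.2)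
        (re_im_div (re_im_mul hFc hS2c) hDc fun z _ => hD0 _)
      exact ⟨h.1.congr fun z _ => by rw [hG1], h.2.congr fun z _ => by rw [hG1]⟩
    have hG2c : IsSemialgebraicFunOn ℚ {z : Fin 1 → ℝ | z 0 ∈ Icc (0 : ℝ) 1} (fun z => (G2 (z 0)).re) ∧
        IsSemialgebraicFunOn ℚ {z : Fin 1 → ℝ | z 0 ∈ Icc (0 : ℝ) 1} (fun z => (G2 (z 0)).im) := by
      have h := re_im_div (re_im_mul hFc (re_im_ofReal hdom hSUM_)) (re_im_pow hdom hDc 2)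
        fun z _ => pow_ne_zero 2 (hD0 _)
      exact ⟨h.1.congr fun z _ => by rw [hG2], h.2.congr fun z _ => by rw [hG2]⟩
    refine IsSemialgebraicMapOn.of_forall hdom fun j => ?_
    refine Fin.addCases (fun i => ?_) (fun i => ?_) j
    · simp only [Fin.append_left]
      fin_cases i
      · exact hG1c.1.congr fun z _ => by simp
      · exact hG2c.1.congr fun z _ => by simp
    · simp only [Fin.append_right]
      fin_cases i
      · exact hG1c.2.congr fun z _ => by simp
      · exact hG2c.2.congr fun z _ => by simp

end Summit.KontsevichZagierPeriods.SymplecticScissors.RealOnePeriodRelations.LoopLayer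

end
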